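import Mathlib
import HarnessLib.Audit
import Summits.PneNP.PneNP.Theorems.PstarGateU2Touch

/-!
# One GATED chord: a PRIVATE SHARED tree edge couples two cycles on the gate chamber (E2; prover-1 g19)

FRONTIER range-avoidance ladder, rung F-N3 (`stmt-PneNP-19007`), cell `pnp-ideate` (`PstarGateNodesX`, nodes N2–N4); restricted-model proof
complexity — nothing here bears on `P` versus `NP`.

Sibling of the four-point lemma `PstarGateU2Touch.touch_core`.  Chords `c, c'`; on the chamber `{x_u = κ}` the zeros of `u_c` force
`u_{c'} = 1`.  Let `π = (a, b)` be a tree edge lying on BOTH fundamental sets whose AND variables are off `u` and appear in no other edge of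
`D c ∪ D c'`.  Along the square `x, x + e_a, x + e_b, x + e_a + e_b` (inside the chamber) both `u_c` and `u_{c'}` change by the SAME increment
`Q_π(x_S) − Q_π(x)`, which takes the value `u_c(x)` for some corner; there `u_c = 0`, so `u_{c'} = 1`, i.e. `u_{c'}(x) + u_c(x) = 1`:

* `polar_single_of_private` — the polar form of `Q_D` against `e_a` is the coordinate `x_b` when `a` lies only on the edge `π = (a,b)` of `D`;
* `coupled_of_private_shared` — **`u_{c'} = u_c + 1` on the whole chamber.**
-/

set_option linter.dupNamespace false -- `Summit.PneNP.PneNP.…`: summit = sub-problem name (D-0017 single-conjunct layout)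

open Finset Literature.Computability.Complexity
open Summit.PneNP.PneNP.Theorems.PstarSALevel (SimpleOverlap)
open Summit.PneNP.PneNP.Theorems.PstarGapLinearised (andPair)
open Summit.PneNP.PneNP.Theorems.PstarChordEndgameTools (mem_andPair_iff)
open Summit.PneNP.PneNP.Theorems.PstarProductRank (qform polar polar_apply)
open Summit.PneNP.PneNP.Theorems.PstarReadSumset (V2)
open Summit.PneNP.PneNP.Theorems.PstarChordSystem (ChordSystem)
open Summit.PneNP.PneNP.Theorems.PstarChordBridge (BridgeData sys)
open Summit.PneNP.PneNP.Theorems.PstarChordBridgeForcing (gam sys_u_eq)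
open Summit.PneNP.PneNP.Theorems.PstarGateHyperplane (qform_single_and)
open Summit.PneNP.PneNP.Theorems.PstarGateCaseTLocal (u_add)

namespace Summit.PneNP.PneNP.Theorems.PstarGateSharedEdge

variable {n m : ℕ}

/-- **The polar form of `Q_D` against `e_a` is the coordinate `x_b`** when the only edge of `D` holding `a` is `π`, whose other AND variable is
`b`. -/
theorem polar_single_of_private (I : LocalMap 4 n m) (hI : I.IsPure xorAndPred) (D : Finset (Fin m)) {π : Fin m} (hπ : π ∈ D) {a b : Fin n}
    (hab : (I.vars π 2 = a ∧ I.vars π 3 = b) ∨ (I.vars π 2 = b ∧ I.vars π 3 = a)) (hpriv : ∀ j ∈ D, j ≠ π → a ∉ andPair I j)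
    (y : Fin n → ZMod 2) : polar D (fun j => I.vars j 2) (fun j => I.vars j 3) (Pi.single a 1) y = y b := by
  rw [polar_apply, ← add_sum_erase D _ hπ]
  have hrest : ∑ j ∈ D.erase π, ((Pi.single a (1 : ZMod 2) : Fin n → ZMod 2) (I.vars j 2) * y (I.vars j 3) +
      (Pi.single a (1 : ZMod 2) : Fin n → ZMod 2) (I.vars j 3) * y (I.vars j 2)) = 0 := by
    refine sum_eq_zero fun j hj => ?_
    obtain ⟨hne, hjD⟩ := mem_erase.1 hj
    have hna := hpriv j hjD hne
    have h2 : I.vars j 2 ≠ a := fun h => hna ((mem_andPair_iff I j a).2 (Or.inl h.symm))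
    have h3 : I.vars j 3 ≠ a := fun h => hna ((mem_andPair_iff I j a).2 (Or.inr h.symm))
    rw [Pi.single_eq_of_ne h2, Pi.single_eq_of_ne h3, zero_mul, zero_mul, add_zero]
  rw [hrest, add_zero]
  have h23 : I.vars π 2 ≠ I.vars π 3 := fun h => absurd (hI.2 π h) (by decide)
  have hab' : a ≠ b := by
    rcases hab with ⟨h2, h3⟩ | ⟨h2, h3⟩
    · rw [← h2, ← h3]; exact h23
    · rw [← h2, ← h3]; exact h23.symm
  rcases hab with ⟨h2, h3⟩ | ⟨h2, h3⟩
  · rw [h2, h3, Pi.single_eq_same, Pi.single_eq_of_ne (Ne.symm hab'), one_mul, zero_mul, add_zero]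
  · rw [h2, h3, Pi.single_eq_same, Pi.single_eq_of_ne (Ne.symm hab'), one_mul, zero_mul, zero_add]

/-- The finite check behind `coupled_of_private_shared`. -/
private theorem couple_aux (U U' xa xb : ZMod 2) (f0 : U = 0 → U' = 1) (f1 : U + xb = 0 → U' + xb = 1)
    (f2 : U + xa = 0 → U' + xa = 1) (f3 : U + xa + xb + 1 = 0 → U' + xa + xb + 1 = 1) : U' = U + 1 := by
  have z01 : ∀ t : ZMod 2, t = 0 ∨ t = 1 := by decide
  rcases z01 U with rfl | rfl
  · rw [f0 rfl]; decide
  · rcases z01 xa with rfl | rfl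
    · rcases z01 xb with rfl | rfl
      · have h := f3 (by decide); clear f0 f1 f2 f3; revert h; revert U'; decide
      · have h := f1 (by decide); clear f0 f1 f2 f3; revert h; revert U'; decide
    · have h := f2 (by decide); clear f0 f1 f2 f3; revert h; revert U'; decide

/-- **A private shared tree edge couples the two cycles on the chamber.**  See the module docstring. -/
theorem coupled_of_private_shared (I : LocalMap 4 n m) (hI : I.IsPure xorAndPred) {B : BridgeData n m} {c c' : Fin m} (u : Fin n) (κ : ZMod 2)
    (hforce : ∀ x : Fin n → ZMod 2, x u = κ → (sys I B).u c x = 0 → (sys I B).u c' x = 1)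
    {π : Fin m} (hπc : π ∈ B.D c) (hπc' : π ∈ B.D c') (h2u : I.vars π 2 ≠ u) (h3u : I.vars π 3 ≠ u)
    (hpc : ∀ j ∈ B.D c, j ≠ π → I.vars π 2 ∉ andPair I j ∧ I.vars π 3 ∉ andPair I j)
    (hpc' : ∀ j ∈ B.D c', j ≠ π → I.vars π 2 ∉ andPair I j ∧ I.vars π 3 ∉ andPair I j) :
    ∀ x : Fin n → ZMod 2, x u = κ → (sys I B).u c' x = (sys I B).u c x + 1 := by
  intro x hxu
  set a := I.vars π 2 with ha
  set b := I.vars π 3 with hb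
  set ea : Fin n → ZMod 2 := Pi.single a 1 with hea
  set eb : Fin n → ZMod 2 := Pi.single b 1 with heb
  have hab : a ≠ b := fun h => absurd (hI.2 π h) (by decide)
  have heau : ea u = 0 := by rw [hea, Pi.single_eq_of_ne (Ne.symm h2u)]
  have hebu : eb u = 0 := by rw [heb, Pi.single_eq_of_ne (Ne.symm h3u)]
  -- the common increments along the square
  have e3 : ∀ p q r : ZMod 2, p + q + q + r = p + r := by decide
  have hinc : ∀ d : Fin m, π ∈ B.D d → (∀ j ∈ B.D d, j ≠ π → a ∉ andPair I j ∧ b ∉ andPair I j) →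
      ((sys I B).u d (x + ea) = (sys I B).u d x + x b) ∧ ((sys I B).u d (x + eb) = (sys I B).u d x + x a) ∧
      ((sys I B).u d (x + ea + eb) = (sys I B).u d x + x a + x b + 1) := by
    intro d hπd hpd
    have hQ0 : ∀ v : Fin n, (sys I B).u d (Pi.single v 1) = (sys I B).u d 0 := by
      intro v; rw [sys_u_eq, sys_u_eq, qform_single_and I hI]; unfold qform; simp
    have hpa : ∀ y, polar (B.D d) (fun j => I.vars j 2) (fun j => I.vars j 3) ea y = y b := fun y =>
      polar_single_of_private I hI (B.D d) hπd (Or.inl ⟨ha.symm, hb.symm⟩) (fun j hj hne => (hpd j hj hne).1) y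
    have hpb : ∀ y, polar (B.D d) (fun j => I.vars j 2) (fun j => I.vars j 3) eb y = y a := fun y =>
      polar_single_of_private I hI (B.D d) hπd (Or.inr ⟨ha.symm, hb.symm⟩) (fun j hj hne => (hpd j hj hne).2) y
    have hsym := PstarPathRank.polar_symm_and I (B.D d)
    have k1 := u_add I B d x ea
    have k2 := u_add I B d x eb
    have k3 := u_add I B d (x + ea) eb
    rw [hsym x ea, hpa x, hea, hQ0 a] at k1
    rw [hsym x eb, hpb x, heb, hQ0 b] at k2
    rw [hsym (x + ea) eb, hpb (x + ea), heb, hQ0 b, Pi.add_apply, hea, Pi.single_eq_same] at k3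
    rw [← hea] at k1
    rw [← heb] at k2 k3
    refine ⟨by rw [k1, e3], by rw [k2, e3], ?_⟩
    rw [k3, k1]
    have e6 : ∀ p q t r : ZMod 2, p + q + q + t + q + q + (r + 1) = p + r + t + 1 := by decide
    exact e6 _ _ _ _
  obtain ⟨c1, c2, c3⟩ := hinc c hπc hpc
  obtain ⟨d1, d2, d3⟩ := hinc c' hπc' hpc'
  have hxau : (x + ea) u = κ := by rw [Pi.add_apply, hxu, heau, add_zero]
  have hxbu : (x + eb) u = κ := by rw [Pi.add_apply, hxu, hebu, add_zero]
  have hxabu : (x + ea + eb) u = κ := by rw [Pi.add_apply, Pi.add_apply, hxu, heau, hebu, add_zero, add_zero]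
  have f0 := hforce x hxu
  have f1 := hforce (x + ea) hxau
  have f2 := hforce (x + eb) hxbu
  have f3 := hforce (x + ea + eb) hxabu
  rw [c1, d1] at f1
  rw [c2, d2] at f2
  rw [c3, d3] at f3
  exact couple_aux _ _ _ _ f0 f1 f2 f3

end Summit.PneNP.PneNP.Theorems.PstarGateSharedEdge
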